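import Summits.QuantumFields.YangMills.Theorems.PoincareLipschitzFlatBlockMassRieszLog
import Literature.MathematicalPhysics.QuantumFieldTheory.Balaban1983to89.B4Thm19ZeroLattice
import HarnessLib

/-!
# Line «poincare_lipschitz» on crux `HistoryTailL` (stmt-QuantumFields-19936), route crux `BlockLipschitzL` (stmt-QuantumFields-23533), K2 organ M-COUL —
# «BLOCK-MASS step 3», FILE 3: THE LOCALISED (WEIGHTED) FORM OF THE SHARP BLOCK-MASS RIESZ BOUND — near data at the price `log n`, far data at the price
# `n·e^{−δ₀·dist∕n}`: for `h = G_k(0)∂^{η*}f` and `x ∈ Q_{R₀}(x₀)`,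
# `|n(h(x+e_μ) − h(x))| ≤ C·(log₂(n+1)+1)·sup_{Q_R(x₀)}|f| + c₀·e^{−δ₀(R−R₀)∕n}·2(d+1)·n·sup|f|`

Cell `ym3-torus` (YM ladder rung R3 = continuum SU(2) Yang–Mills on the three-torus — a RUNG, NOT the Clay problem: not d = 4, not infinite volume, not a
mass gap); width seat `ym3-torus-px7` gen 5 (LEAD ym-ust-19936-w1 g8 ruling (R1) 2026-08-29T03:44:46Z «px7 owns the SEQUEL BLOCK-MASS step 3 = REGION∕WEIGHT FORM … +
the `e^{−δd∕n}`-weighted version of (C) that LP-3's “kernel concentrated on O(L)” wants»; 03:50:24Z GO).  THEOREMS ONLY (def-free) over ★w5-19936 g11's step 2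
✓`PoincareLipschitzFlatBlockMassRieszLog.blockMass_gradient_le_log` (the sharp global headline, REAL data) and lit ✓`B4Thm19ZeroLattice.GkLat_weightedRowD_le` (the
(1.10) derivative clause, exponentially weighted rows of `∂^η_μG_k(0)`); `--supports stmt-QuantumFields-19936`.  Nothing here proves hG, hLow, the per-bond charts,
`hStab`, F6, a stub, `BlockLipschitzL`, `HistoryTailL` or a summit statement.

WHY.  The organ of record `hG` (M-COUL-G per level, card v1.35 (e)) and the LP-architecture's (LP-3) read the Coulomb-chart kernel as «concentrated on O(L) blocks»:
the gradient at `x` should see the data NEAR `x` at the Riesz price `log n` and the data FAR from `x` only through the block-mass decay `e^{−δ₀·dist∕n}`.  Step 2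
gives `C·(log₂(n+1)+1)·sup|f|` with the GLOBAL sup.  This file splits `f = f·1_{Q_R(x₀)} + f·1_{Q_R(x₀)^c}` (the solution is linear in the data): the near piece is
step 2 VERBATIM with the near sup; the far piece's adjoint difference `∂^{η*}(f·1_{Q_R^c})` is supported outside `Q_{R−1}(x₀)`, hence at sup-distance `≥ R − R₀` from
`x ∈ Q_{R₀}(x₀)`, and the weighted row bound of (1.10) gives `c₀·e^{−δ₀(R−R₀)∕n}·‖∂^{η*}f_far‖_∞ ≤ c₀·e^{−δ₀(R−R₀)∕n}·2(d+1)·n·sup|f|` (the crude `n` of step 1 is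
harmless here: it is beaten by the exponential as soon as `R − R₀ ≳ n·log n`).

* §1 `adjDivR_add` (linearity of `∂^{η*}`), `abs_adjDivR_le` (`|∂^{η*}f| ≤ 2(d+1)·n·sup|f|`), `adjDivR_far_eq_zero` (the far data's `∂^{η*}` vanishes on `Q_{R−1}(x₀)`),
  `le_supNorm_of_not_mem_box` (`z ∉ Q_{R−1}(x₀)`, `x ∈ Q_{R₀}(x₀)` ⇒ `R − R₀ ≤ |x − z|_∞`), `sum_kernel_mul_le_of_weighted` (the far estimate from a weighted row bound).
* §2 ★★★ `exists_blockMass_gradient_le_log_localised` — the title.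
HONEST.  Flat (`A = 0`), scalar, zero-field lineage; nothing covariant ∕ multiscale; YM₃ on T³ is rung R3, not the Clay problem.
[folklore] ([Balaban1983RegularityDecay] Theorem (1.10) p.573 (derivative clause), Lemma 2.2 (2.17) p.578; [Balaban1984PropagatorsII] (1.9) p.226; [Giaquinta1984] Ch. III §3).
-/

set_option autoImplicit false

noncomputable section

open scoped BigOperators
open Finset

namespace Summit.QuantumFields.YangMills.Theorems.PoincareLipschitzFlatBlockMassRieszLocalised

open Literature.MathematicalPhysics.QuantumFieldTheory.Balaban1983to89
open B4Eq19LatticeOperators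
open B4ContourShift (supNorm supNorm_nonneg abs_le_supNorm)
open B3GkZeroLattice (GkLat)
open B4Thm19ZeroLattice (GkLat_weightedRowD_le)
open Summit.QuantumFields.YangMills.Theorems.PoincareLipschitzFlatBlockMassRieszLog (blockMass_gradient_le_log)

variable {d : ℕ}

/-! ## §1 Bookkeeping: linearity, size and support of `∂^{η*}`; the far estimate -/

/-- `∂^{η*}` is additive in the data. [folklore] -/
theorem adjDivR_add (n : ℝ) (f g : Zd (d + 1) → Fin (d + 1) → ℝ) (z : Zd (d + 1)) :
    ∑ ν, n * ((f (z - Pi.single ν 1) ν + g (z - Pi.single ν 1) ν) - (f z ν + g z ν)) =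
      (∑ ν, n * (f (z - Pi.single ν 1) ν - f z ν)) + ∑ ν, n * (g (z - Pi.single ν 1) ν - g z ν) := by
  rw [← Finset.sum_add_distrib]
  exact Finset.sum_congr rfl fun ν _ => by ring

/-- `|(∂^{η*}f)(z)| ≤ 2(d+1)·n·F` when `|f| ≤ F` (`n ≥ 0`). [folklore] -/
theorem abs_adjDivR_le {n : ℝ} (hn : 0 ≤ n) {f : Zd (d + 1) → Fin (d + 1) → ℝ} {F : ℝ} (hf : ∀ z ν, |f z ν| ≤ F) (z : Zd (d + 1)) :
    |∑ ν, n * (f (z - Pi.single ν 1) ν - f z ν)| ≤ 2 * ((d : ℝ) + 1) * n * F := by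
  calc |∑ ν, n * (f (z - Pi.single ν 1) ν - f z ν)| ≤ ∑ ν, |n * (f (z - Pi.single ν 1) ν - f z ν)| := Finset.abs_sum_le_sum_abs _ _
    _ ≤ ∑ _ν : Fin (d + 1), n * (2 * F) := Finset.sum_le_sum fun ν _ => by
        rw [abs_mul, abs_of_nonneg hn]
        refine mul_le_mul_of_nonneg_left ?_ hn
        calc |f (z - Pi.single ν 1) ν - f z ν| ≤ |f (z - Pi.single ν 1) ν| + |f z ν| := abs_sub _ _
          _ ≤ F + F := add_le_add (hf _ _) (hf _ _)
          _ = 2 * F := by ring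
    _ = 2 * ((d : ℝ) + 1) * n * F := by
        rw [Finset.sum_const, Finset.card_univ, Fintype.card_fin, nsmul_eq_mul]; push_cast; ring

/-- THE FAR DATA'S ADJOINT DIFFERENCE VANISHES ON `Q_{R−1}(x₀)`: if `g(z,ν) = 0` for `z ∈ Q_R(x₀)`, then `(∂^{η*}g)(z) = 0` for `z ∈ Q_{R−1}(x₀)`
(`z` and `z − e_ν` lie in `Q_R(x₀)`). [folklore] -/
theorem adjDivR_far_eq_zero (n : ℝ) {g : Zd (d + 1) → Fin (d + 1) → ℝ} {x₀ : Zd (d + 1)} {R : ℤ}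
    (hg : ∀ z ∈ box x₀ R, ∀ ν, g z ν = 0) {z : Zd (d + 1)} (hz : z ∈ box x₀ (R - 1)) :
    ∑ ν, n * (g (z - Pi.single ν 1) ν - g z ν) = 0 := by
  refine Finset.sum_eq_zero fun ν _ => ?_
  have h1 : g z ν = 0 := hg z (box_mono x₀ (by linarith) hz) ν
  have h2 : g (z - Pi.single ν 1) ν = 0 := by
    have hm : z - unitVec ν ∈ box x₀ (R - 1 + 1) := sub_unitVec_mem_box hz ν
    rw [sub_add_cancel] at hm
    exact hg _ hm ν
  rw [h1, h2, sub_zero, mul_zero]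

/-- SUPPORT ⇒ DISTANCE: `z ∉ Q_{R−1}(x₀)` and `x ∈ Q_{R₀}(x₀)` give `R − R₀ ≤ |x − z|_∞`. [folklore] -/
theorem le_supNorm_of_not_mem_box {x₀ x z : Zd (d + 1)} {R R₀ : ℤ} (hz : z ∉ box x₀ (R - 1)) (hx : x ∈ box x₀ R₀) :
    ((R : ℝ) - R₀) ≤ supNorm (x - z) := by
  rw [mem_box] at hz hx
  obtain ⟨i, hi⟩ := not_forall.1 hz
  have hi' : R - 1 < |z i - x₀ i| := not_le.1 hi
  have hxi := hx i
  have h1 : R - R₀ ≤ |(x - z) i| := by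
    rw [Pi.sub_apply]
    have := abs_sub_abs_le_abs_sub (z i - x₀ i) (x i - x₀ i)
    have e : z i - x₀ i - (x i - x₀ i) = -( (x i - z i)) := by ring
    rw [e, abs_neg] at this
    have hR : R ≤ |z i - x₀ i| := by linarith
    linarith
  have h2 : ((R : ℝ) - R₀) ≤ ((|(x - z) i| : ℤ) : ℝ) := by exact_mod_cast h1
  exact h2.trans (abs_le_supNorm (x - z) i)

/-- ★ **THE FAR ESTIMATE FROM A WEIGHTED ROW BOUND**: if `Σ_{z∈F} |K(z)|·e^{δ₀|x−z|_∞∕n} ≤ c₀` for every finite `F` (`δ₀ ≥ 0`), `|g| ≤ M` (`M ≥ 0`) and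
`g(z) ≠ 0 ⇒ D ≤ |x − z|_∞`, then `|Σ_{z∈T} K(z)·g(z)| ≤ c₀·e^{−δ₀D∕n}·M` for every finite `T`.
[cite: Balaban1983RegularityDecay, Theorem (1.10) p.573, derivative clause — the printed shape «c₀exp(−δ₀dist(x, supp f))‖f‖_∞»] -/
theorem sum_kernel_mul_le_of_weighted {K g : Zd (d + 1) → ℝ} {x : Zd (d + 1)} {n δ₀ c₀ M D : ℝ} (hn : 0 < n) (hδ₀ : 0 ≤ δ₀)
    (hK : ∀ F : Finset (Zd (d + 1)), ∑ z ∈ F, |K z| * Real.exp (δ₀ * supNorm (x - z) / n) ≤ c₀) (hM : 0 ≤ M)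
    (hg : ∀ z, |g z| ≤ M) (hD : ∀ z, g z ≠ 0 → D ≤ supNorm (x - z)) (T : Finset (Zd (d + 1))) :
    |∑ z ∈ T, K z * g z| ≤ c₀ * Real.exp (-(δ₀ * D / n)) * M := by
  have hpt : ∀ z, |K z * g z| ≤ (|K z| * Real.exp (δ₀ * supNorm (x - z) / n)) * (Real.exp (-(δ₀ * D / n)) * M) := by
    intro z
    by_cases hz : g z = 0
    · rw [hz, mul_zero, abs_zero]; positivity
    · have hDz := hD z hz
      have hexp : 1 ≤ Real.exp (δ₀ * supNorm (x - z) / n) * Real.exp (-(δ₀ * D / n)) := by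
        rw [← Real.exp_add]
        apply Real.one_le_exp
        have : δ₀ * D / n ≤ δ₀ * supNorm (x - z) / n :=
          div_le_div_of_nonneg_right (mul_le_mul_of_nonneg_left hDz hδ₀) hn.le
        linarith
      rw [abs_mul]
      calc |K z| * |g z| ≤ |K z| * M := mul_le_mul_of_nonneg_left (hg z) (abs_nonneg _)
        _ = |K z| * 1 * M := by ring
        _ ≤ |K z| * (Real.exp (δ₀ * supNorm (x - z) / n) * Real.exp (-(δ₀ * D / n))) * M :=
            mul_le_mul_of_nonneg_right (mul_le_mul_of_nonneg_left hexp (abs_nonneg _)) hM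
        _ = (|K z| * Real.exp (δ₀ * supNorm (x - z) / n)) * (Real.exp (-(δ₀ * D / n)) * M) := by ring
  calc |∑ z ∈ T, K z * g z| ≤ ∑ z ∈ T, |K z * g z| := Finset.abs_sum_le_sum_abs _ _
    _ ≤ ∑ z ∈ T, (|K z| * Real.exp (δ₀ * supNorm (x - z) / n)) * (Real.exp (-(δ₀ * D / n)) * M) := Finset.sum_le_sum fun z _ => hpt z
    _ = (∑ z ∈ T, |K z| * Real.exp (δ₀ * supNorm (x - z) / n)) * (Real.exp (-(δ₀ * D / n)) * M) := by rw [Finset.sum_mul]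
    _ ≤ c₀ * (Real.exp (-(δ₀ * D / n)) * M) := mul_le_mul_of_nonneg_right (hK T) (by positivity)
    _ = c₀ * Real.exp (-(δ₀ * D / n)) * M := by ring

/-! ## §2 ★★★ The localised headline -/

/-- ★★★ **BLOCK-MASS step 3 — THE LOCALISED (WEIGHTED) FORM.**  For `d`, `L = ℓ+1 ≥ 2` and a window `a ∈ [a₋,a₊]` (`a₋ > 0`), `m² ∈ [0,m²₊]` there are
`C, δ₀, c₀ > 0` such that for every `k ≥ 1` (`n = L^k`), window point, axis `μ`, centre `x₀`, radii `0 ≤ R₀`, `R₀ + 1 ≤ R`, point `x ∈ Q_{R₀}(x₀)`, real bond data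
`f` vanishing off a finite `S` (`S' ⊇ S` closed under `z ↦ z + e_ν` from `S`) with `|f| ≤ F_near` on `Q_R(x₀)` and `|f| ≤ F_far` everywhere, ★w5's solution
`h(y) = Σ_{x'∈S'} G_k(0)(y,x')·(∂^{η*}f)(x')` obeys
`|n(h(x+e_μ) − h(x))| ≤ C·(log₂(n+1)+1)·F_near + c₀·e^{−δ₀(R−R₀)∕n}·(2(d+1)·n·F_far)`
— the Riesz logarithm only sees the data within `R` of `x₀`; everything farther is damped by the block mass.  (`C` = step 2's constant; `δ₀, c₀` = (1.10)'s.)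
[cite: Balaban1983RegularityDecay, Theorem (1.10) p.573 (derivative clause), Lemma 2.2 (2.17) p.578; Balaban1984PropagatorsII, (1.9) p.226] -/
theorem exists_blockMass_gradient_le_log_localised (d ℓ : ℕ) (hℓ : 1 ≤ ℓ) (amin aplus m2plus : ℝ) (ha : 0 < amin) :
    ∃ C δ₀ c₀ : ℝ, 0 < C ∧ 0 < δ₀ ∧ 0 < c₀ ∧ ∀ (k : ℕ), 1 ≤ k → ∀ (a m2 : ℝ), amin ≤ a → a ≤ aplus → 0 ≤ m2 → m2 ≤ m2plus →
      ∀ (μ : Fin (d + 1)) (x₀ x : Zd (d + 1)) (f : Zd (d + 1) → Fin (d + 1) → ℝ) (S S' : Finset (Zd (d + 1))) (R R₀ : ℤ) (Fnear Ffar : ℝ),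
        (∀ z ∉ S, ∀ ν, f z ν = 0) → S ⊆ S' → (∀ z ∈ S, ∀ ν, z + Pi.single ν 1 ∈ S') → 0 ≤ Fnear → 0 ≤ Ffar →
        (∀ z ∈ box x₀ R, ∀ ν, |f z ν| ≤ Fnear) → (∀ z ν, |f z ν| ≤ Ffar) → x ∈ box x₀ R₀ → 0 ≤ R₀ → R₀ + 1 ≤ R →
        |(((ℓ + 1) ^ k : ℕ) : ℝ) *
            ((∑ x' ∈ S', GkLat ℓ k a m2 (x + Pi.single μ 1) x' *
                ∑ ν, (((ℓ + 1) ^ k : ℕ) : ℝ) * (f (x' - Pi.single ν 1) ν - f x' ν)) -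
              ∑ x' ∈ S', GkLat ℓ k a m2 x x' * ∑ ν, (((ℓ + 1) ^ k : ℕ) : ℝ) * (f (x' - Pi.single ν 1) ν - f x' ν))|
          ≤ C * ((Nat.log 2 ((ℓ + 1) ^ k + 1) : ℝ) + 1) * Fnear +
            c₀ * Real.exp (-(δ₀ * ((R : ℝ) - R₀) / (((ℓ + 1) ^ k : ℕ) : ℝ))) * (2 * ((d : ℝ) + 1) * (((ℓ + 1) ^ k : ℕ) : ℝ) * Ffar) := by
  classical
  obtain ⟨C, hC, hnear⟩ := blockMass_gradient_le_log d ℓ hℓ amin aplus m2plus ha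
  obtain ⟨δ₀, c₀, hδ₀, hc₀, hrow⟩ := GkLat_weightedRowD_le d ℓ hℓ amin aplus m2plus ha
  refine ⟨C, δ₀, c₀, hC, hδ₀, hc₀, ?_⟩
  intro k hk a m2 h1 h2 h3 h4 μ x₀ x f S S' R R₀ Fnear Ffar hfS hSS' hshift hFn hFf hnearB hfarB hx hR₀ hR
  set n : ℕ := (ℓ + 1) ^ k with hn
  have hn1 : 1 ≤ n := Nat.one_le_pow _ _ (by omega)
  have hnR : (0 : ℝ) < (n : ℝ) := by exact_mod_cast (show 0 < n by omega)
  -- the near ∕ far split of the data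
  set fN : Zd (d + 1) → Fin (d + 1) → ℝ := fun z ν => if z ∈ box x₀ R then f z ν else 0 with hfN
  set fF : Zd (d + 1) → Fin (d + 1) → ℝ := fun z ν => if z ∈ box x₀ R then 0 else f z ν with hfF
  have hsplit : ∀ z ν, f z ν = fN z ν + fF z ν := fun z ν => by
    by_cases hz : z ∈ box x₀ R <;> simp [hfN, hfF, hz]
  -- the adjoint differences
  set g : Zd (d + 1) → ℝ := fun z => ∑ ν, (n : ℝ) * (f (z - Pi.single ν 1) ν - f z ν) with hg
  set gN : Zd (d + 1) → ℝ := fun z => ∑ ν, (n : ℝ) * (fN (z - Pi.single ν 1) ν - fN z ν) with hgN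
  set gF : Zd (d + 1) → ℝ := fun z => ∑ ν, (n : ℝ) * (fF (z - Pi.single ν 1) ν - fF z ν) with hgF
  have hgsplit : ∀ z, g z = gN z + gF z := by
    intro z
    rw [hg, hgN, hgF]
    dsimp only
    rw [← adjDivR_add]
    exact Finset.sum_congr rfl fun ν _ => by rw [← hsplit, ← hsplit]
  -- the gradient expression is additive in the data
  set E : (Zd (d + 1) → ℝ) → ℝ := fun φ =>
    (n : ℝ) * ((∑ x' ∈ S', GkLat ℓ k a m2 (x + Pi.single μ 1) x' * φ x') - ∑ x' ∈ S', GkLat ℓ k a m2 x x' * φ x') with hE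
  have hEsplit : E g = E gN + E gF := by
    simp only [hE]
    have e1 : ∑ x' ∈ S', GkLat ℓ k a m2 (x + Pi.single μ 1) x' * g x' =
        ∑ x' ∈ S', GkLat ℓ k a m2 (x + Pi.single μ 1) x' * gN x' + ∑ x' ∈ S', GkLat ℓ k a m2 (x + Pi.single μ 1) x' * gF x' := by
      rw [← Finset.sum_add_distrib]; exact Finset.sum_congr rfl fun x' _ => by rw [hgsplit, mul_add]
    have e2 : ∑ x' ∈ S', GkLat ℓ k a m2 x x' * g x' = ∑ x' ∈ S', GkLat ℓ k a m2 x x' * gN x' + ∑ x' ∈ S', GkLat ℓ k a m2 x x' * gF x' := by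
      rw [← Finset.sum_add_distrib]; exact Finset.sum_congr rfl fun x' _ => by rw [hgsplit, mul_add]
    rw [e1, e2]; ring
  -- NEAR: step 2 verbatim for `fN`
  have hfNS : ∀ z ∉ S, ∀ ν, fN z ν = 0 := fun z hz ν => by
    by_cases hzb : z ∈ box x₀ R <;> simp [hfN, hzb, hfS z hz ν]
  have hfNb : ∀ z ν, |fN z ν| ≤ Fnear := fun z ν => by
    by_cases hzb : z ∈ box x₀ R
    · simp only [hfN, hzb, if_true]; exact hnearB z hzb ν
    · simp only [hfN, hzb, if_false, abs_zero]; exact hFn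
  have hN := hnear k hk a m2 h1 h2 h3 h4 μ x fN S S' Fnear hfNS hSS' hshift hfNb
  -- FAR: the weighted row bound of (1.10) + support
  have hfFb : ∀ z ν, |fF z ν| ≤ Ffar := fun z ν => by
    by_cases hzb : z ∈ box x₀ R
    · simp only [hfF, hzb, if_true, abs_zero]; exact hFf
    · simp only [hfF, hzb, if_false]; exact hfarB z ν
  have hgFb : ∀ z, |gF z| ≤ 2 * ((d : ℝ) + 1) * n * Ffar := fun z => abs_adjDivR_le hnR.le hfFb z
  have hgF0 : ∀ z ∈ box x₀ (R - 1), gF z = 0 := fun z hz =>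
    adjDivR_far_eq_zero (n : ℝ) (fun w hw ν => by simp only [hfF, hw, if_true]) hz
  have hD : ∀ z, gF z ≠ 0 → ((R : ℝ) - R₀) ≤ supNorm (x - z) := fun z hz =>
    le_supNorm_of_not_mem_box (fun hzb => hz (hgF0 z hzb)) hx
  have hrow' := hrow k hk a m2 h1 h2 h3 h4 μ x
  have hF := sum_kernel_mul_le_of_weighted (K := fun z => (n : ℝ) * (GkLat ℓ k a m2 (x + Pi.single μ 1) z - GkLat ℓ k a m2 x z))
    (g := gF) (x := x) (D := (R : ℝ) - R₀) hnR hδ₀.le (fun F => by simpa only [hn] using hrow' F) (by positivity) hgFb hD S'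
  have hEF : E gF = ∑ z ∈ S', (n : ℝ) * (GkLat ℓ k a m2 (x + Pi.single μ 1) z - GkLat ℓ k a m2 x z) * gF z := by
    simp only [hE]
    rw [mul_sub, Finset.mul_sum, Finset.mul_sum, ← Finset.sum_sub_distrib]
    exact Finset.sum_congr rfl fun z _ => by ring
  -- assemble
  have hgoal : (n : ℝ) * ((∑ x' ∈ S', GkLat ℓ k a m2 (x + Pi.single μ 1) x' * ∑ ν, (n : ℝ) * (f (x' - Pi.single ν 1) ν - f x' ν)) -
      ∑ x' ∈ S', GkLat ℓ k a m2 x x' * ∑ ν, (n : ℝ) * (f (x' - Pi.single ν 1) ν - f x' ν)) = E g := by simp only [hE, hg]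
  rw [hgoal, hEsplit]
  have hNE : |E gN| ≤ C * ((Nat.log 2 (n + 1) : ℝ) + 1) * Fnear := by simpa only [hE, hgN, hn] using hN
  have hFE : |E gF| ≤ c₀ * Real.exp (-(δ₀ * ((R : ℝ) - R₀) / n)) * (2 * ((d : ℝ) + 1) * n * Ffar) := by rw [hEF]; exact hF
  exact (abs_add_le _ _).trans (add_le_add hNE hFE)

end Summit.QuantumFields.YangMills.Theorems.PoincareLipschitzFlatBlockMassRieszLocalised

end
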